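/-
Origin: expansion seat `planner-pub-hodgecm-mc-axioms-1-g14-0`, handover #W171 2026-08-20T15:53:55Z md5 a906a2118a44 (PKG be5c1feb35bf → a906a2118a44; 150 l.; MECHANICAL (iib-R) rewrite v3.1 of the PKG file as it stands (49 token edits; rules R1x2+RX[h₂]x47)) (`HOME/mc/pub-hodgecm-mc-axioms-1-g14/revendor/kit-r55/stage55/HodgeCM/Model/HypCensus/KappaJoinMu34.lean`, md5 a906a2118a44, 150 lines);
landed by the gen-22 packager (p-g22) in gate run 55 REPLACES the earlier landed copy of `HodgeCM/Model/HypCensus/KappaJoinMu34.lean` (seat copy carried the packager Origin header of an earlier run (stripped)).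
-/
/-
Origin: speedrun cell pub-hodgecm, MODEL-CONSTRUCTION sub-cell, lineage mc-binder-2 (BINDER-OWNERS rows 18/19: E binders
`hyp12`/`hyp34`), seat `prover-pub-hodgecm-mc-binder-2-g14-0`, gen 14; (T12)/(B1′) second table (RULING S5b); private mirror certified.
-/
import Summits.HodgeConjecture.HodgeCM.Model.HypCensus.KappaJoin
import Summits.HodgeConjecture.HodgeCM.Model.HypCensus.OmgInsAll34
import Summits.HodgeConjecture.HodgeCM.Model.ArchPinWeightDischarge34

/-!
# Row 19 at the R1 pin, (B1′) census, MODULO THE (J-μ)₃₄ SCALAR IDENTITY ONLY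

The junction hypothesis `homg₃₄` of #78 `hyp34_of_census_R1At` (`HypCensus/KappaJoin` §3, torus twist `σ`) is DISCHARGED AT THE
TWISTED CENSUS `σ := sigma34 c.D` (RULING S5b (B1′): the `W`-line indices at a `Σ₁₂` place read through `placePerm⁻¹`, so that the (34)
Weil `Σ`-factor — the (12) one at `swapPin u` — matches the printed orientation place by place) by N4 `omgW_ins₃₄_eq_of_weight`, leaving
as the ONLY named residual of row 19 the (J-μ)₃₄ scalar identity read at `swapPin c.D u_t` (theta-3's (K14)):

* **`hyp34_of_census_R1At_of_hμ₃₄ (hc) (hK) (hcan) (jD) (hμ₃₄)`** (row 18's twin `hyp12_of_census_R1At_of_hμ` / `_GOG` is `KappaJoinMu`);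
* **`hyp34_of_census_R1At_GOG (hc) (hK) (hcan) (jD)`** — at E's pin of record (`χW := SInstance.χWR … (μ♯♯)`, `μ♯♯ := muSharp₂₃ μ`): (K14)
  `ArchSideTerm.hμ₃₄_GOG` plugged in, NO named residual — E's binder `hyp34` at one good canonical context is a THEOREM of the constructed pin.

No `Prop`-valued definitions; no records; the W family, pin and context hypotheses are those of #78 verbatim.
-/

noncomputable section

open scoped TensorProduct InnerProductSpace Matrix Topology Classical
open Filter
open NumberField NumberField.InfinitePlace

namespace HodgeCM.Model.HypCensus

open HodgeCM HodgeCM.Model HodgeCM.Universe HodgeCM.Adelic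
open HodgeCM.Universe (AdelicThetaCore AdelicThetaCore₀ SideData ThetaModel)
open HodgeCM.PerL34 HodgeCM.PerL34.ArchC HodgeCM.PerL34.Fock HodgeCM.PerL34.Fock.PrintDict
open HodgeCM.Model.ArchSideTerm (e₁ posIdxEquivUnit negIdxEquivEmpty lambdaExponent dW' dW'_real dW'_ne)
open Literature.AlgebraicGeometry.HodgeTheory
open Literature.NumberTheory.Automorphic.PicardCM
open Literature.NumberTheory.Transcendental (Arapura2012_Cor_15_4_6)
open Literature.NumberTheory.Automorphic (piSchwartzBruhat FinSB)
open Literature.NumberTheory.Automorphic.UnitaryGroup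
open Literature.NumberTheory.Weil1964 (repWeilThetaDatum PosIdx NegIdx)
open Literature.NumberTheory.GelbartRogawski1991 Literature.NumberTheory.GelbartRogawski1991.UnitaryDualPair
open Literature.RepresentationTheory.CompactGroups (UnitaryGroupChar.diagU UnitaryGroupChar.coe_diagU)
open NumberField.SeesawArchTorus

/-! ## Row 19 at the R1 pin from (J-μ)₃₄ -/

section R1

variable (hHD : exists_isReal_hodgeModel) (hI : hodgePQ_independent_of_hodgeModel)
  (h₁ : BallQuotientUniformised)  (h₃ : CMAbelianVarietyRealised)
variable (hA : Arapura2012_Cor_15_4_6)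
variable
  (hGR : ∀ {L : CMField} {ι₁ : L →+* ℂ} (V : HermSpace3 L ι₁) (c : SeesawCtx L),
    (cmSplittingDatum (L : Type) finProdFinEquiv (frameD V) (frameD_real V) (frameD_ne V) (dW c.D) (dW_real c.D) (dW_ne c.D)).CompatibleSplitting)
  (hGR₀ : ∀ {L : CMField} {ι₁ : L →+* ℂ} (V : HermSpace3 L ι₁) (c : SeesawCtx L),
    (cmSplittingDatum (L : Type) (e₁) (frameD V) (frameD_real V) (frameD_ne V) (lineVec (L : Type) (dW c.D 0))
      (fun _ => dW_real c.D 0) (fun _ => dW_ne c.D 0)).CompatibleSplitting)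
  (hGR₁ : ∀ {L : CMField} {ι₁ : L →+* ℂ} (V : HermSpace3 L ι₁) (c : SeesawCtx L),
    (cmSplittingDatum (L : Type) (e₁) (frameD V) (frameD_real V) (frameD_ne V) (lineVec (L : Type) (dW c.D 1))
      (fun _ => dW_real c.D 1) (fun _ => dW_ne c.D 1)).CompatibleSplitting)
  (χW : ∀ {L : CMField} {ι₁ : L →+* ℂ} (_V : HermSpace3 L ι₁) (_c : SeesawCtx L),
    ContinuousMonoidHom (Literature.NumberTheory.Automorphic.relNormOneIdeles (maximalRealSubfield (L : Type)) (L : Type) ⧸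
      Literature.NumberTheory.Automorphic.relNormOneRat (maximalRealSubfield (L : Type)) (L : Type)) Circle)
  (S : ∀ {L : CMField} {ι₁ : L →+* ℂ} (V : HermSpace3 L ι₁) (c : SeesawCtx L), ThetaAdelicSide V c)
  (μ : ∀ {L : CMField}, SeesawCtx L → Fin 4 → InfinitePlace L → ℤ)
variable {L : CMField} {ι₁ : L →+* ℂ} (V : HermSpace3 L ι₁) (c : SeesawCtx L)

/-- **ROW 19 (`hyp34`) AT THE R1 PIN MODULO (J-μ)₃₄ ONLY**: #78 `hyp34_of_census_R1At` AT THE TWISTED CENSUS `σ := sigma34 c.D`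
((B1′) orientation), its junction `homg₃₄` supplied by N4 `omgW_ins₃₄_eq_of_weight` from the scalar identity `hμ₃₄` read at `swapPin c.D u_t`
(torus `jT₃₄`, exponents `(−μ₂, −μ₃)`). -/
theorem hyp34_of_census_R1At_of_hμ₃₄
    (hc : (thetaModelOf hHD hI h₁ h₃ (orientBitι L ι₁) (_root_.HodgeCM.Model.embOf hHD hI h₁ h₃) (coverOf hHD hI h₁ h₃ hA) (wmOfInput (Wcm hGR (EtaChi.η (@SInstance.χVR @hGR @hGR₀ @hGR₁) @χW) (EtaChi.hη (@SInstance.χVR @hGR @hGR₀ @hGR₁) @χW) (EtaChi.hηc (@SInstance.χVR @hGR @hGR₀ @hGR₁) @χW))) (thetaOf _ (thetaClassInputOf _ (fun V c => thetaSpaceInputOf hHD hI h₁ h₃ S V c))) (d12Of μ) (d34Of μ)).GoodCtx ι₁ c)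
    (hK : Module.finrank ℚ c.K = 6) (hcan : (InfinitePlace.mk ι₁).embedding = ι₁)
    (jD : InfinitePlace (L : Type) → EqVar → Fin 6)
    (hμ₃₄ : ∀ (hW : (∀ j, 0 < (ι₁ ((dW c.D) j)).re) ∨ ∀ j, (ι₁ ((dW c.D) j)).re < 0)
      (t : (placesAt34 V c.D hW jD (fun w => -μ c 2 w) (fun w => -μ c 3 w)).Tg),
      muScalar34 V c.D (hGR V c) (EtaChi.η (@SInstance.χVR @hGR @hGR₀ @hGR₁) @χW V c) hW jD (fun w => -μ c 2 w) (fun w => -μ c 3 w) t *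
          dIotaAt (L : Type) (frameD V) (dW c.D) (dW_real c.D) ι₁ (swapPin c.D (archOf V c.D (datumAtσ V c.D jD (jIOf V c.D hW) (sigma34 c.D)) (fun w => -μ c 2 w) (fun w => -μ c 3 w) t)) =
        (printPlacesW (InfinitePlace (L : Type))
          (kindOf (L : Type) (frameD V) (frameD_real V) (dW c.D) (dW_real c.D) ι₁ (datumAtσ V c.D jD (jIOf V c.D hW) (sigma34 c.D)))
          (lamOf (L : Type) (frameD V) (frameD_real V) (dW c.D) (dW_real c.D) ι₁ (datumAtσ V c.D jD (jIOf V c.D hW) (sigma34 c.D)))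
          (lamOf_ne_zero (L : Type) (frameD V) (frameD_real V) (dW c.D) (dW_real c.D) ι₁ (datumAtσ V c.D jD (jIOf V c.D hW) (sigma34 c.D)))
          (pinnedVacs (kindOf (L : Type) (frameD V) (frameD_real V) (dW c.D) (dW_real c.D) ι₁ (datumAtσ V c.D jD (jIOf V c.D hW) (sigma34 c.D))) (fun w => -μ c 2 w) (fun w => -μ c 3 w)) t)⁻¹) :
    Nonempty (((coreOf _ (_root_.HodgeCM.Model.embOf hHD hI h₁ h₃) (coverOf hHD hI h₁ h₃ hA) (wmOfInput (Wcm hGR (EtaChi.η (@SInstance.χVR @hGR @hGR₀ @hGR₁) @χW) (EtaChi.hη (@SInstance.χVR @hGR @hGR₀ @hGR₁) @χW) (EtaChi.hηc (@SInstance.χVR @hGR @hGR₀ @hGR₁) @χW))) (thetaOf _ (thetaClassInputOf _ (fun V c => thetaSpaceInputOf hHD hI h₁ h₃ S V c)))).toCore (orientBitι L ι₁)).HypSmoothCore34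
      (((coreOf _ (_root_.HodgeCM.Model.embOf hHD hI h₁ h₃) (coverOf hHD hI h₁ h₃ hA) (wmOfInput (Wcm hGR (EtaChi.η (@SInstance.χVR @hGR @hGR₀ @hGR₁) @χW) (EtaChi.hη (@SInstance.χVR @hGR @hGR₀ @hGR₁) @χW) (EtaChi.hηc (@SInstance.χVR @hGR @hGR₀ @hGR₁) @χW))) (thetaOf _ (thetaClassInputOf _ (fun V c => thetaSpaceInputOf hHD hI h₁ h₃ S V c)))).toCore (orientBitι L ι₁)).side12 (d12Of μ)) (((coreOf _ (_root_.HodgeCM.Model.embOf hHD hI h₁ h₃) (coverOf hHD hI h₁ h₃ hA) (wmOfInput (Wcm hGR (EtaChi.η (@SInstance.χVR @hGR @hGR₀ @hGR₁) @χW) (EtaChi.hη (@SInstance.χVR @hGR @hGR₀ @hGR₁) @χW) (EtaChi.hηc (@SInstance.χVR @hGR @hGR₀ @hGR₁) @χW))) (thetaOf _ (thetaClassInputOf _ (fun V c => thetaSpaceInputOf hHD hI h₁ h₃ S V c)))).toCore (orientBitι L ι₁)).side34 (d34Of μ))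
      ((((coreOf _ (_root_.HodgeCM.Model.embOf hHD hI h₁ h₃) (coverOf hHD hI h₁ h₃ hA) (wmOfInput (Wcm hGR (EtaChi.η (@SInstance.χVR @hGR @hGR₀ @hGR₁) @χW) (EtaChi.hη (@SInstance.χVR @hGR @hGR₀ @hGR₁) @χW) (EtaChi.hηc (@SInstance.χVR @hGR @hGR₀ @hGR₁) @χW))) (thetaOf _ (thetaClassInputOf _ (fun V c => thetaSpaceInputOf hHD hI h₁ h₃ S V c)))).toCore (orientBitι L ι₁)).analyticKM (((coreOf _ (_root_.HodgeCM.Model.embOf hHD hI h₁ h₃) (coverOf hHD hI h₁ h₃ hA) (wmOfInput (Wcm hGR (EtaChi.η (@SInstance.χVR @hGR @hGR₀ @hGR₁) @χW) (EtaChi.hη (@SInstance.χVR @hGR @hGR₀ @hGR₁) @χW) (EtaChi.hηc (@SInstance.χVR @hGR @hGR₀ @hGR₁) @χW))) (thetaOf _ (thetaClassInputOf _ (fun V c => thetaSpaceInputOf hHD hI h₁ h₃ S V c)))).toCore (orientBitι L ι₁)).side12 (d12Of μ))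
        (((coreOf _ (_root_.HodgeCM.Model.embOf hHD hI h₁ h₃) (coverOf hHD hI h₁ h₃ hA) (wmOfInput (Wcm hGR (EtaChi.η (@SInstance.χVR @hGR @hGR₀ @hGR₁) @χW) (EtaChi.hη (@SInstance.χVR @hGR @hGR₀ @hGR₁) @χW) (EtaChi.hηc (@SInstance.χVR @hGR @hGR₀ @hGR₁) @χW))) (thetaOf _ (thetaClassInputOf _ (fun V c => thetaSpaceInputOf hHD hI h₁ h₃ S V c)))).toCore (orientBitι L ι₁)).side34 (d34Of μ))).toAnalytic) V c (ℓ := linOfInput (Wcm hGR (EtaChi.η (@SInstance.χVR @hGR @hGR₀ @hGR₁) @χW) (EtaChi.hη (@SInstance.χVR @hGR @hGR₀ @hGR₁) @χW) (EtaChi.hηc (@SInstance.χVR @hGR @hGR₀ @hGR₁) @χW)) V c)) :=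
  hyp34_of_census_R1At hHD hI h₁ h₃ hA hGR hGR₀ hGR₁ χW S μ V c hc hK hcan jD (σ := sigma34 c.D) fun hW f t φ =>
    omgW_ins₃₄_eq_of_weight V c.D (hGR V c) (EtaChi.η (@SInstance.χVR @hGR @hGR₀ @hGR₁) @χW V c) (EtaChi.hη (@SInstance.χVR @hGR @hGR₀ @hGR₁) @χW V c) (EtaChi.hηc (@SInstance.χVR @hGR @hGR₀ @hGR₁) @χW V c)
      ι₁ V.sylvesterFrame (sylvesterFrame_formCongr V) hW jD (fun w => -μ c 2 w) (fun w => -μ c 3 w) (hμ₃₄ hW) f t φ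

end R1



/-! ## Row 19 at E's pin of record: NO named residual (theta-3's (K14) `hμ₃₄_GOG` plugged in) -/

section GOG

variable (hHD : exists_isReal_hodgeModel) (hI : hodgePQ_independent_of_hodgeModel)
  (h₁ : BallQuotientUniformised)  (h₃ : CMAbelianVarietyRealised)
variable (hA : Arapura2012_Cor_15_4_6)
variable
  (hGR : ∀ {L : CMField} {ι₁ : L →+* ℂ} (V : HermSpace3 L ι₁) (c : SeesawCtx L),
    (cmSplittingDatum (L : Type) finProdFinEquiv (frameD V) (frameD_real V) (frameD_ne V) (dW c.D) (dW_real c.D) (dW_ne c.D)).CompatibleSplitting)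
  (hGR₀ : ∀ {L : CMField} {ι₁ : L →+* ℂ} (V : HermSpace3 L ι₁) (c : SeesawCtx L),
    (cmSplittingDatum (L : Type) (e₁) (frameD V) (frameD_real V) (frameD_ne V) (lineVec (L : Type) (dW c.D 0))
      (fun _ => dW_real c.D 0) (fun _ => dW_ne c.D 0)).CompatibleSplitting)
  (hGR₁ : ∀ {L : CMField} {ι₁ : L →+* ℂ} (V : HermSpace3 L ι₁) (c : SeesawCtx L),
    (cmSplittingDatum (L : Type) (e₁) (frameD V) (frameD_real V) (frameD_ne V) (lineVec (L : Type) (dW c.D 1))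
      (fun _ => dW_real c.D 1) (fun _ => dW_ne c.D 1)).CompatibleSplitting)
  (hGR₂ : ∀ {L : CMField} {ι₁ : L →+* ℂ} (V : HermSpace3 L ι₁) (c : SeesawCtx L),
    (cmSplittingDatum (L : Type) (e₁) (frameD V) (frameD_real V) (frameD_ne V) (lineVec (L : Type) (dW' c.D 0))
      (fun _ => dW'_real c.D 0) (fun _ => dW'_ne c.D 0)).CompatibleSplitting)
  (hGR₃ : ∀ {L : CMField} {ι₁ : L →+* ℂ} (V : HermSpace3 L ι₁) (c : SeesawCtx L),
    (cmSplittingDatum (L : Type) (e₁) (frameD V) (frameD_real V) (frameD_ne V) (lineVec (L : Type) (dW' c.D 1))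
      (fun _ => dW'_real c.D 1) (fun _ => dW'_ne c.D 1)).CompatibleSplitting)
  (S : ∀ {L : CMField} {ι₁ : L →+* ℂ} (V : HermSpace3 L ι₁) (c : SeesawCtx L), ThetaAdelicSide V c)
  (μ : ∀ {L : CMField}, SeesawCtx L → Fin 4 → InfinitePlace L → ℤ)
variable {L : CMField} {ι₁ : L →+* ℂ} (V : HermSpace3 L ι₁) (c : SeesawCtx L)

include hGR₂ hGR₃ in
/-- **ROW 19 (`hyp34`) AT E's PIN OF RECORD WITH NO NAMED RESIDUAL**: `hyp34_of_census_R1At_of_hμ₃₄` ((B1′) census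
`σ := sigma34 c.D`) at the Stage-B character `χW := SInstance.χWR … (μ♯♯)`, exponents `μ♯♯ := muSharp₂₃ μ` (glue-1's #398-lineage
instantiation of #78), its (J-μ)₃₄ identity at `swapPin c.D u_t` supplied by theta-3's (K14) `ArchSideTerm.hμ₃₄_GOG` (OG guard `⟨hcan, hc'⟩`);
the census datum `jD` and the side family `S` stay free: (V-val) #78 · (J-dense) #70 · (J-T34) N4 · (J-μ)₃₄ (K14). -/
theorem hyp34_of_census_R1At_GOG
    (hc : (thetaModelOf hHD hI h₁ h₃ (orientBitι L ι₁) (_root_.HodgeCM.Model.embOf hHD hI h₁ h₃) (coverOf hHD hI h₁ h₃ hA) (wmOfInput (Wcm hGR (EtaChi.η (@SInstance.χVR @hGR @hGR₀ @hGR₁) (@SInstance.χWR @hGR @hGR₀ @hGR₁ (ArchSideTerm.muSharp₂₃ @μ))) (EtaChi.hη (@SInstance.χVR @hGR @hGR₀ @hGR₁) (@SInstance.χWR @hGR @hGR₀ @hGR₁ (ArchSideTerm.muSharp₂₃ @μ))) (EtaChi.hηc (@SInstance.χVR @hGR @hGR₀ @hGR₁) (@SInstance.χWR @hGR @hGR₀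 @hGR₁ (ArchSideTerm.muSharp₂₃ @μ))))) (thetaOf _ (thetaClassInputOf _ (fun V c => thetaSpaceInputOf hHD hI h₁ h₃ S V c))) (d12Of (ArchSideTerm.muSharp₂₃ @μ)) (d34Of (ArchSideTerm.muSharp₂₃ @μ))).GoodCtx ι₁ c)
    (hK : Module.finrank ℚ c.K = 6) (hcan : (InfinitePlace.mk ι₁).embedding = ι₁)
    (jD : InfinitePlace (L : Type) → EqVar → Fin 6) :
    Nonempty (((coreOf _ (_root_.HodgeCM.Model.embOf hHD hI h₁ h₃) (coverOf hHD hI h₁ h₃ hA) (wmOfInput (Wcm hGR (EtaChi.η (@SInstance.χVR @hGR @hGR₀ @hGR₁) (@SInstance.χWR @hGR @hGR₀ @hGR₁ (ArchSideTerm.muSharp₂₃ @μ))) (EtaChi.hη (@SInstance.χVR @hGR @hGR₀ @hGR₁) (@SInstance.χWR @hGR @hGR₀ @hGR₁ (ArchSideTerm.muSharp₂₃ @μ))) (EtaChi.hηc (@SInstance.χVR @hGR @hGR₀ @hGR₁) (@SInstance.χWR @hGR @hGR₀ @hGR₁ (ArchSideTerm.muSharp₂₃ @μ))))) (thetaOf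 _ (thetaClassInputOf _ (fun V c => thetaSpaceInputOf hHD hI h₁ h₃ S V c)))).toCore (orientBitι L ι₁)).HypSmoothCore34
      (((coreOf _ (_root_.HodgeCM.Model.embOf hHD hI h₁ h₃) (coverOf hHD hI h₁ h₃ hA) (wmOfInput (Wcm hGR (EtaChi.η (@SInstance.χVR @hGR @hGR₀ @hGR₁) (@SInstance.χWR @hGR @hGR₀ @hGR₁ (ArchSideTerm.muSharp₂₃ @μ))) (EtaChi.hη (@SInstance.χVR @hGR @hGR₀ @hGR₁) (@SInstance.χWR @hGR @hGR₀ @hGR₁ (ArchSideTerm.muSharp₂₃ @μ))) (EtaChi.hηc (@SInstance.χVR @hGR @hGR₀ @hGR₁) (@SInstance.χWR @hGR @hGR₀ @hGR₁ (ArchSideTerm.muSharp₂₃ @μ))))) (thetaOf _ (thetaClassInputOf _ (fun V c => thetaSpaceInputOf hHD hI h₁ h₃ S V c)))).toCore (orientBitι L ι₁)).side12 (d12Of (ArchSideTerm.muSharp₂₃ @μ))) (((coreOf _ (_root_.HodgeCM.Model.embOf hHD hI h₁ h₃) (coverOf hHD hI h₁ h₃ hA) (wmOfInput (Wcm hGR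 (EtaChi.η (@SInstance.χVR @hGR @hGR₀ @hGR₁) (@SInstance.χWR @hGR @hGR₀ @hGR₁ (ArchSideTerm.muSharp₂₃ @μ))) (EtaChi.hη (@SInstance.χVR @hGR @hGR₀ @hGR₁) (@SInstance.χWR @hGR @hGR₀ @hGR₁ (ArchSideTerm.muSharp₂₃ @μ))) (EtaChi.hηc (@SInstance.χVR @hGR @hGR₀ @hGR₁) (@SInstance.χWR @hGR @hGR₀ @hGR₁ (ArchSideTerm.muSharp₂₃ @μ))))) (thetaOf _ (thetaClassInputOf _ (fun V c => thetaSpaceInputOf hHD hI h₁ h₃ S V c)))).toCore (orientBitι L ι₁)).side34 (d34Of (ArchSideTerm.muSharp₂₃ @μ)))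
      ((((coreOf _ (_root_.HodgeCM.Model.embOf hHD hI h₁ h₃) (coverOf hHD hI h₁ h₃ hA) (wmOfInput (Wcm hGR (EtaChi.η (@SInstance.χVR @hGR @hGR₀ @hGR₁) (@SInstance.χWR @hGR @hGR₀ @hGR₁ (ArchSideTerm.muSharp₂₃ @μ))) (EtaChi.hη (@SInstance.χVR @hGR @hGR₀ @hGR₁) (@SInstance.χWR @hGR @hGR₀ @hGR₁ (ArchSideTerm.muSharp₂₃ @μ))) (EtaChi.hηc (@SInstance.χVR @hGR @hGR₀ @hGR₁) (@SInstance.χWR @hGR @hGR₀ @hGR₁ (ArchSideTerm.muSharp₂₃ @μ))))) (thetaOf _ (thetaClassInputOf _ (fun V c => thetaSpaceInputOf hHD hI h₁ h₃ S V c)))).toCore (orientBitι L ι₁)).analyticKM (((coreOf _ (_root_.HodgeCM.Model.embOf hHD hI h₁ h₃) (coverOf hHD hI h₁ h₃ hA) (wmOfInput (Wcm hGR (EtaChi.η (@SInstance.χVR @hGR @hGR₀ @hGR₁) (@SInstance.χWR @hGR @hGR₀ @hGR₁ (ArchSideTerm.muSharp₂₃ @μ))) (EtaChi.hη (@SInstance.χVR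 @hGR @hGR₀ @hGR₁) (@SInstance.χWR @hGR @hGR₀ @hGR₁ (ArchSideTerm.muSharp₂₃ @μ))) (EtaChi.hηc (@SInstance.χVR @hGR @hGR₀ @hGR₁) (@SInstance.χWR @hGR @hGR₀ @hGR₁ (ArchSideTerm.muSharp₂₃ @μ))))) (thetaOf _ (thetaClassInputOf _ (fun V c => thetaSpaceInputOf hHD hI h₁ h₃ S V c)))).toCore (orientBitι L ι₁)).side12 (d12Of (ArchSideTerm.muSharp₂₃ @μ)))
        (((coreOf _ (_root_.HodgeCM.Model.embOf hHD hI h₁ h₃) (coverOf hHD hI h₁ h₃ hA) (wmOfInput (Wcm hGR (EtaChi.η (@SInstance.χVR @hGR @hGR₀ @hGR₁) (@SInstance.χWR @hGR @hGR₀ @hGR₁ (ArchSideTerm.muSharp₂₃ @μ))) (EtaChi.hη (@SInstance.χVR @hGR @hGR₀ @hGR₁) (@SInstance.χWR @hGR @hGR₀ @hGR₁ (ArchSideTerm.muSharp₂₃ @μ))) (EtaChi.hηc (@SInstance.χVR @hGR @hGR₀ @hGR₁) (@SInstance.χWR @hGR @hGR₀ @hGR₁ (ArchSideTerm.muSharp₂₃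 @μ))))) (thetaOf _ (thetaClassInputOf _ (fun V c => thetaSpaceInputOf hHD hI h₁ h₃ S V c)))).toCore (orientBitι L ι₁)).side34 (d34Of (ArchSideTerm.muSharp₂₃ @μ)))).toAnalytic) V c (ℓ := linOfInput (Wcm hGR (EtaChi.η (@SInstance.χVR @hGR @hGR₀ @hGR₁) (@SInstance.χWR @hGR @hGR₀ @hGR₁ (ArchSideTerm.muSharp₂₃ @μ))) (EtaChi.hη (@SInstance.χVR @hGR @hGR₀ @hGR₁) (@SInstance.χWR @hGR @hGR₀ @hGR₁ (ArchSideTerm.muSharp₂₃ @μ))) (EtaChi.hηc (@SInstance.χVR @hGR @hGR₀ @hGR₁) (@SInstance.χWR @hGR @hGR₀ @hGR₁ (ArchSideTerm.muSharp₂₃ @μ)))) V c)) :=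
  have hc' : SignRecipe.GoodCtx (orientBitι L ι₁) ι₁ c :=
    ((cpinC hHD hI h₁ h₃ hA (Wcm hGR (EtaChi.η (@SInstance.χVR @hGR @hGR₀ @hGR₁) (@SInstance.χWR @hGR @hGR₀ @hGR₁ (ArchSideTerm.muSharp₂₃ @μ))) (EtaChi.hη (@SInstance.χVR @hGR @hGR₀ @hGR₁) (@SInstance.χWR @hGR @hGR₀ @hGR₁ (ArchSideTerm.muSharp₂₃ @μ))) (EtaChi.hηc (@SInstance.χVR @hGR @hGR₀ @hGR₁) (@SInstance.χWR @hGR @hGR₀ @hGR₁ (ArchSideTerm.muSharp₂₃ @μ)))) S).thetaModel_goodCtx_iff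
      (orientBitι L ι₁) (d12Of (ArchSideTerm.muSharp₂₃ @μ)) (d34Of (ArchSideTerm.muSharp₂₃ @μ)) ι₁ c).mp hc
  hyp34_of_census_R1At_of_hμ₃₄ hHD hI h₁ h₃ hA hGR hGR₀ hGR₁ (@SInstance.χWR @hGR @hGR₀ @hGR₁ (ArchSideTerm.muSharp₂₃ @μ)) S (ArchSideTerm.muSharp₂₃ @μ) V c hc hK hcan jD
    fun hW t => ArchSideTerm.hμ₃₄_GOG hGR (@SInstance.χVR @hGR @hGR₀ @hGR₁) hGR₀ hGR₁ hGR₂ hGR₃ μ V c ⟨hcan, hc'⟩ hW _ t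

end GOG

end HodgeCM.Model.HypCensus

end
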